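import Summits.QuantumAdvantage.AdviceFreeQNC0.HammingLayerSums
import HarnessLib

/-!
# Cell qa-qnc0 (rung F-Q1, route RingFrame, crux β): bookkeeping lemmas for the residue-avoidance theorem

Side conditions for applying Srinivasan's robust Hegedűs lemma (Srinivasan 2023, Lemma 3.1; tree
theorem `Hegedus.nzFrac_lt_of_lowDeg`) to the partner layer `k ∈ {m − q, m + q}`,
`k ≡ r (mod 3)`, of a window layer `m ≢ r (mod 3)` (`partner_facts`), the two threshold
comparisons in the middle half (`threshold_a`, `threshold_b`: with `λn < q² ≤ 16λn` and
`α(n,k) ∈ [1/4, 1/2]`, hypothesis (1a) is implied by density `≤ min(e^{−6400λ}, 1/1000)` and the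
conclusion gives density `< e^{−λ/50}`), `e^{−λ/50} ≤ γ/4` for `λ ≥ 200/γ` (`exp_neg_le_quarter`),
and the Chebyshev tail outside the window `|2m − n| < 2q` (`sum_choose_not_window_le`).
Consumed by `LowDegreeResidueAvoidance.lean`. WHAT THIS IS NOT: nothing on crux α; no separation.
-/

noncomputable section

namespace Summit.QuantumAdvantage.AdviceFreeQNC0

open Finset
open Literature.Computability.MetaComplexity Literature.Computability.MetaComplexity.Smolensky
open Literature.Computability.MetaComplexity.Hegedus

variable {n : ℕ}

/-- If `q ≢ 0`, `a + q ≢ r` and `a + 2q ≢ r (mod 3)`, then `a ≡ r (mod 3)`: the three layers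
`a, a + q, a + 2q` cover all residues mod `3`. [folklore] -/
theorem mod_three_eq_of_ne {a q r : ℕ} (hq : q % 3 ≠ 0) (h1 : (a + q) % 3 ≠ r % 3)
    (h2 : (a + q + q) % 3 ≠ r % 3) : a % 3 = r % 3 := by
  have hq' : q % 3 = 1 ∨ q % 3 = 2 := by omega
  rcases hq' with hq' | hq' <;> omega

/-- Bookkeeping for the partner layer `k ∈ {m - q, m + q}`, `k ≡ r (mod 3)`, of a window layer
`m ≢ r (mod 3)` (`|2m - n| < 2q`, `256q ≤ n`): `k` satisfies the side conditions of Lemma 3.1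
(`100q < k < n - 100q`), lies in the middle half (`n/4 ≤ k ≤ 3n/4`) and within `2q` of the middle.
[folklore] -/
theorem partner_facts {n q m r k : ℕ} (h256 : 256 * q ≤ n) (hq3 : q % 3 ≠ 0)
    (hm : m < n + 1) (hw : n < 2 * m + 2 * q ∧ 2 * m < n + 2 * q) (hne : m % 3 ≠ r % 3)
    (hk : k = if (m + q) % 3 = r % 3 then m + q else m - q) :
    k % 3 = r % 3 ∧ 100 * q < k ∧ k + 100 * q < n ∧ n ≤ 4 * k ∧ 4 * k ≤ 3 * n ∧
      n / 2 ≤ k + 2 * q ∧ k ≤ n - n / 2 + 2 * q ∧ k ≤ n ∧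
      ((k = m + q ∧ (m + q) % 3 = r % 3) ∨ (k = m - q ∧ q ≤ m ∧ (m + q) % 3 ≠ r % 3)) := by
  split_ifs at hk with hc
  · subst hk
    omega
  · have hqm : q ≤ m := by omega
    obtain ⟨a, rfl⟩ : ∃ a, m = a + q := ⟨m - q, by omega⟩
    have hmod : a % 3 = r % 3 := mod_three_eq_of_ne hq3 hne (by
      intro h; exact hc (by rw [show a + q + q = a + q + q from rfl] at h; exact h))
    rw [Nat.add_sub_cancel] at hk
    subst hk
    refine ⟨hmod, ?_, ?_, ?_, ?_, ?_, ?_, ?_, Or.inr ⟨by omega, hqm, hc⟩⟩ <;> omega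

/-- Threshold (1a) of Lemma 3.1 in the middle half: `q² ≤ 16Ln` and `α ≥ 1/4` give
`e^{-6400L} ≤ e^{-100q²/(nα)}`. [cite: Srinivasan2023, Lemma 3.1 (hypothesis (1a))] -/
theorem threshold_a {n q k : ℕ} {L εA : ℝ} (hn0 : 0 < n) (h1 : n ≤ 4 * k)
    (h2 : 4 * k ≤ 3 * n) (hqq : (q : ℝ) ^ 2 ≤ 16 * (L * n))
    (hεAexp : εA ≤ Real.exp (-(6400 * L))) (hεAle : εA ≤ 1 / 1000) :
    εA ≤ min (Real.exp (-(100 * (q : ℝ) ^ 2 / (n * alphaOf n k)))) (1 / 1000) := by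
  have hnR : (0 : ℝ) < n := by exact_mod_cast hn0
  have hα := quarter_le_alphaOf hn0 h1 h2
  have hαpos : 0 < alphaOf n k := by linarith
  refine le_min (le_trans hεAexp (Real.exp_le_exp.2 ?_)) hεAle
  have : 100 * (q : ℝ) ^ 2 / (n * alphaOf n k) ≤ 6400 * L := by
    rw [div_le_iff₀ (mul_pos hnR hαpos)]
    nlinarith [mul_le_mul_of_nonneg_left hα (by positivity : (0 : ℝ) ≤ 4 * (q : ℝ) ^ 2),
      mul_le_mul_of_nonneg_right hqq hαpos.le]
  linarith

/-- Threshold (1b) of Lemma 3.1 in the middle half: `Ln < q²` and `α ≤ 1/2` give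
`e^{-q²/(100nα)} ≤ e^{-L/50}`. [cite: Srinivasan2023, Lemma 3.1 (hypothesis (1b))] -/
theorem threshold_b {n q k : ℕ} {L : ℝ} (hn0 : 0 < n) (h1 : n ≤ 4 * k)
    (h2 : 4 * k ≤ 3 * n) (hLn : L * n < (q : ℝ) ^ 2) :
    Real.exp (-((q : ℝ) ^ 2 / (100 * n * alphaOf n k))) ≤ Real.exp (-(L / 50)) := by
  have hnR : (0 : ℝ) < n := by exact_mod_cast hn0
  have hα := quarter_le_alphaOf hn0 h1 h2
  have hα2 := alphaOf_le_half n k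
  have hαpos : 0 < alphaOf n k := by linarith
  apply Real.exp_le_exp.2
  have : L / 50 ≤ (q : ℝ) ^ 2 / (100 * n * alphaOf n k) := by
    rw [div_le_div_iff₀ (by norm_num) (mul_pos (mul_pos (by norm_num) hnR) hαpos)]
    nlinarith [mul_le_mul_of_nonneg_left hα2 (by positivity : (0 : ℝ) ≤ 100 * n),
      mul_le_mul_of_nonneg_right hLn.le hαpos.le]
  linarith

/-- `e^{-L/50} ≤ γ/4` once `L ≥ 200/γ`. [folklore] -/
theorem exp_neg_le_quarter {γ L : ℝ} (hγ : 0 < γ) (hLγ : 200 / γ ≤ L) :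
    Real.exp (-(L / 50)) ≤ γ / 4 := by
  have h1 : Real.exp (-(L / 50)) ≤ Real.exp (-(4 / γ)) := by
    apply Real.exp_le_exp.2
    have h3 : 4 / γ ≤ L / 50 := by
      rw [div_le_div_iff₀ hγ (by norm_num)]
      have h4 : 200 ≤ L * γ := by
        have := mul_le_mul_of_nonneg_right hLγ hγ.le
        rwa [div_mul_cancel₀ _ hγ.ne'] at this
      linarith
    linarith
  have h2 : Real.exp (-(4 / γ)) ≤ γ / 4 := by
    rw [Real.exp_neg, inv_le_comm₀ (Real.exp_pos _) (by positivity)]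
    have := Real.add_one_le_exp (4 / γ)
    have e : (γ / 4)⁻¹ = 4 / γ := by rw [inv_div]
    rw [e]; linarith
  linarith

/-- The layers outside the window `|2m - n| < 2q` carry at most `n·2ⁿ/(4q²)` points of the cube
(Chebyshev). [folklore] -/
theorem sum_choose_not_window_le (n q : ℕ) (hq : 0 < q) :
    ∑ m ∈ (range (n + 1)).filter (fun m => ¬(n < 2 * m + 2 * q ∧ 2 * m < n + 2 * q)),
      (n.choose m : ℝ) ≤ n * (2 : ℝ) ^ n / (4 * (q : ℝ) ^ 2) := by
  have hqR : (0 : ℝ) < q := by exact_mod_cast hq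
  have hsub : (range (n + 1)).filter (fun m => ¬(n < 2 * m + 2 * q ∧ 2 * m < n + 2 * q)) ⊆
      (range (n + 1)).filter (fun m : ℕ => 4 * (q : ℝ) ^ 2 ≤ (2 * (m : ℝ) - n) ^ 2) := by
    intro m hm
    rw [mem_filter] at hm ⊢
    refine ⟨hm.1, ?_⟩
    rcases not_and_or.1 hm.2 with h | h
    · have h' : 2 * (m : ℝ) + 2 * q ≤ n := by
        have : 2 * m + 2 * q ≤ n := by omega
        exact_mod_cast this
      nlinarith [mul_nonneg (by linarith : (0 : ℝ) ≤ n - 2 * m - 2 * q)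
        (by linarith : (0 : ℝ) ≤ n - 2 * m + 2 * q)]
    · have h' : (n : ℝ) + 2 * q ≤ 2 * m := by
        have : n + 2 * q ≤ 2 * m := by omega
        exact_mod_cast this
      nlinarith [mul_nonneg (by linarith : (0 : ℝ) ≤ 2 * m - n - 2 * q)
        (by linarith : (0 : ℝ) ≤ 2 * m - n + 2 * q)]
  have h4q : (0 : ℝ) < 4 * (q : ℝ) ^ 2 := mul_pos (by norm_num) (pow_pos hqR 2)
  exact le_trans (sum_le_sum_of_subset_of_nonneg hsub fun m _ _ => Nat.cast_nonneg _)
    (sum_choose_filter_le_div n h4q)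

end Summit.QuantumAdvantage.AdviceFreeQNC0
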